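import Literature.NumberTheory.Sieve.LinearEquationsInPrimesCrudeBounds
import Mathlib.Data.Nat.Log
import HarnessLib

/-!
# Linear equations in primes: the sandwich between `∑ ∏ Λ(ψᵢ(n))` and the prime-point count

The combinatorial core of Green–Tao's deduction "Conjecture 1.2 implies Conjecture 1.4"
(B. Green, T. Tao, *Linear equations in primes*, Ann. of Math. 171 (2010), sketch proof after
(1.8): "The contribution … where `min |ψᵢ(n)| ≤ N^{1-ε}` can easily be shown to be [small] by crude
estimates … The contribution … where at least one of the `ψᵢ(n)` is a power of a prime `p², p³, …`
can similarly be shown to be `o(N^d)`. Finally, for the remaining non-zero contributions …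
`∏ Λ(ψᵢ(n))` is equal to `(1 + O(tε)) log^t N`."):

* `card_filter_eval_mem_le`: at most `#V · (2N+1)^{d-1}` points `n` of the box have `ψ(n) ∈ V`
  (from `card_filter_eval_eq_le` of `LinearEquationsInPrimesCrudeBounds`), whence
  `card_filter_abs_eval_le` (`|ψ(n)| ≤ Y` for at most `(2Y+1)(2N+1)^{d-1}` points) and
  `card_filter_higherPrimePow_le` (`ψ(n)` is a prime power `p^k ≤ X`, `k ≥ 2`, for at most
  `√X log₂ X (2N+1)^{d-1}` points, as such prime powers number `≤ √X log₂ X`,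
  `card_image_pow_le`);
* `vonMangoldtSum_primePointCount_sandwich`: for a threshold `Y ≥ 1`, `0 ≤ a ≤ log Y` and
  `log(2LN) ≤ b`, writing `g` for the number of points of `K ∩ [-N,N]^d ∩ ℤ^d` all of whose
  values `ψᵢ(n)` are primes `> Y`, `β` for the number with some `|ψᵢ(n)| ≤ Y` and `γ` for the
  number with some `ψᵢ(n)` a higher prime power, one has
  `a^t g ≤ ∑ ∏ Λ(ψᵢ(n)) ≤ b^t (g + β + γ)`, `g ≤ #{prime points} ≤ g + β`, and the crude bounds
  `β ≤ t(2Y+1)(2N+1)^{d-1}`, `γ ≤ t √(2LN) log₂(2LN) (2N+1)^{d-1}`.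

The deduction itself (growth bookkeeping and Conjecture 1.2) is `LinearEquationsInPrimesCount`.
Everything here is elementary; no result beyond Mathlib and `LinearEquationsInPrimesCrudeBounds`
(`|ψᵢ(n)| ≤ 2LN` on the box, `0 ≤ Λ(m) ≤ log`) is used.

## References

* B. Green, T. Tao, *Linear equations in primes*, Ann. of Math. (2) 171 (2010), 1753–1850
  (arXiv:math/0606088), §1: (1.1), (1.2), Conj. 1.4, (1.8) and the sketch proof following it.
-/

noncomputable section

open Finset
open scoped ArithmeticFunction.vonMangoldt

namespace Literature.NumberTheory.Sieve

variable {d t : ℕ}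

/-! ### Size of a nondegenerate system -/

/-- A nondegenerate system of size `≤ L` with at least one form forces `1 ≤ L`
(some coefficient is a nonzero integer). [folklore] -/
theorem one_le_of_affLinSize_le {N : ℕ} {L : ℝ} (Ψ : Fin t → AffLinForm d)
    (hΨ : IsNondegenerateSystem Ψ) (hL : affLinSize Ψ N ≤ L) (i : Fin t) : 1 ≤ L := by
  obtain ⟨j, hj⟩ : ∃ j, (Ψ i).coeff j ≠ 0 := Function.ne_iff.mp (hΨ.1 i)
  have h1 : (1 : ℝ) ≤ |((Ψ i).coeff j : ℝ)| := by
    rw [← Int.cast_abs]; exact_mod_cast Int.one_le_abs hj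
  refine le_trans ?_ hL
  unfold affLinSize
  have h2 : |((Ψ i).coeff j : ℝ)| ≤ ∑ j, |((Ψ i).coeff j : ℝ)| :=
    Finset.single_le_sum (f := fun j => |((Ψ i).coeff j : ℝ)|) (fun j _ => abs_nonneg _)
      (Finset.mem_univ j)
  have h3 : ∑ j, |((Ψ i).coeff j : ℝ)| ≤ ∑ i, ∑ j, |((Ψ i).coeff j : ℝ)| :=
    Finset.single_le_sum (f := fun i => ∑ j, |((Ψ i).coeff j : ℝ)|)
      (fun i _ => Finset.sum_nonneg fun j _ => abs_nonneg _) (Finset.mem_univ i)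
  have h4 : 0 ≤ ∑ i, |((Ψ i).const : ℝ) / N| := Finset.sum_nonneg fun i _ => abs_nonneg _
  linarith

/-! ### Crude counting: points of the box with prescribed values of one form -/

/-- **Crude count.** If `ψ̇ ≠ 0` then, among the lattice points of any `s ⊆ [-N, N]^d`, at most
`#V · (2N+1)^{d-1}` have `ψ(n) ∈ V` (each value is taken at most `(2N+1)^{d-1}` times,
`card_filter_eval_eq_le`). This is the "crude estimate" invoked in Green–Tao's sketch proof of
Conj. 1.4. [cite: GreenTao2010, Conj. 1.4 (sketch proof)] -/
theorem card_filter_eval_mem_le {N : ℕ} (ψ : AffLinForm d) (hψ : ψ.coeff ≠ 0) (V : Finset ℤ)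
    (s : Finset (Fin d → ℤ)) (hs : s ⊆ latticeBox d N) [DecidablePred fun n => ψ.eval n ∈ V] :
    #(s.filter fun n => ψ.eval n ∈ V) ≤ #V * (2 * N + 1) ^ (d - 1) := by
  classical
  obtain ⟨j₀, hj₀⟩ : ∃ j, ψ.coeff j ≠ 0 := Function.ne_iff.mp hψ
  calc #(s.filter fun n => ψ.eval n ∈ V)
      ≤ #(V.biUnion fun v => (latticeBox d N).filter fun n => ψ.eval n = v) := by
        refine Finset.card_le_card fun n hn => ?_
        rw [Finset.mem_filter] at hn
        rw [Finset.mem_biUnion]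
        exact ⟨ψ.eval n, hn.2, Finset.mem_filter.mpr ⟨hs hn.1, rfl⟩⟩
    _ ≤ ∑ v ∈ V, #((latticeBox d N).filter fun n => ψ.eval n = v) := Finset.card_biUnion_le
    _ ≤ ∑ _v ∈ V, (2 * N + 1) ^ (d - 1) :=
        Finset.sum_le_sum fun v _ => card_filter_eval_eq_le ψ hj₀ N v
    _ = #V * (2 * N + 1) ^ (d - 1) := by rw [Finset.sum_const, smul_eq_mul]

/-- At most `(2Y+1)(2N+1)^{d-1}` points `n` of `s ⊆ [-N, N]^d` have `|ψ(n)| ≤ Y` (`ψ̇ ≠ 0`).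
[cite: GreenTao2010, Conj. 1.4 (sketch proof)] -/
theorem card_filter_abs_eval_le {N : ℕ} {Y : ℝ} (hY : 0 ≤ Y) (ψ : AffLinForm d) (hψ : ψ.coeff ≠ 0)
    (s : Finset (Fin d → ℤ)) (hs : s ⊆ latticeBox d N)
    [DecidablePred fun n : Fin d → ℤ => |(ψ.eval n : ℝ)| ≤ Y] :
    (#(s.filter fun n => |(ψ.eval n : ℝ)| ≤ Y) : ℝ) ≤ (2 * Y + 1) * (2 * N + 1) ^ (d - 1) := by
  classical
  set V : Finset ℤ := Icc (-⌊Y⌋) ⌊Y⌋ with hV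
  have h0 : 0 ≤ ⌊Y⌋ := Int.floor_nonneg.mpr hY
  have hVcard : (#V : ℝ) ≤ 2 * Y + 1 := by
    have h1 : (#V : ℤ) = 2 * ⌊Y⌋ + 1 := by
      rw [hV, Int.card_Icc, Int.toNat_of_nonneg (by omega)]
      ring
    have h2 : (#V : ℝ) = 2 * (⌊Y⌋ : ℝ) + 1 := by exact_mod_cast h1
    rw [h2]
    linarith [Int.floor_le Y]
  have h1 : #(s.filter fun n => |(ψ.eval n : ℝ)| ≤ Y) ≤ #V * (2 * N + 1) ^ (d - 1) := by
    calc #(s.filter fun n => |(ψ.eval n : ℝ)| ≤ Y)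
        ≤ #(s.filter fun n => ψ.eval n ∈ V) := by
          refine Finset.card_le_card fun n hn => ?_
          rw [Finset.mem_filter] at hn ⊢
          refine ⟨hn.1, ?_⟩
          have h := abs_le.mp hn.2
          rw [hV, Finset.mem_Icc]
          constructor
          · have : -ψ.eval n ≤ ⌊Y⌋ := Int.le_floor.mpr (by push_cast; linarith [h.1])
            omega
          · exact Int.le_floor.mpr h.2
      _ ≤ #V * (2 * N + 1) ^ (d - 1) := card_filter_eval_mem_le ψ hψ V s hs
  calc (#(s.filter fun n => |(ψ.eval n : ℝ)| ≤ Y) : ℝ) ≤ (#V : ℝ) * (2 * N + 1) ^ (d - 1) := by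
        exact_mod_cast h1
    _ ≤ (2 * Y + 1) * (2 * N + 1) ^ (d - 1) := by gcongr

/-! ### Higher prime powers are rare -/

/-- A prime power `m = p^k ≤ X` which is not a prime (`k ≥ 2`) is of the form `a^k` with
`2 ≤ a ≤ √X`, `2 ≤ k ≤ log₂ X`. [folklore] -/
theorem mem_image_pow_of_isPrimePow {X m : ℕ} (hm : IsPrimePow m) (hm' : ¬ m.Prime)
    (hmX : m ≤ X) :
    m ∈ ((Icc 2 X.sqrt) ×ˢ (Icc 2 (Nat.log 2 X))).image fun pk : ℕ × ℕ => pk.1 ^ pk.2 := by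
  rw [isPrimePow_nat_iff] at hm
  obtain ⟨p, k, hp, hk, rfl⟩ := hm
  have hk2 : 2 ≤ k := by
    by_contra hk2
    obtain rfl : k = 1 := by omega
    exact hm' (by simpa using hp)
  rw [Finset.mem_image]
  refine ⟨(p, k), Finset.mem_product.mpr ⟨Finset.mem_Icc.mpr ⟨hp.two_le, ?_⟩,
    Finset.mem_Icc.mpr ⟨hk2, ?_⟩⟩, rfl⟩
  · rw [Nat.le_sqrt]
    calc p * p = p ^ 2 := (sq p).symm
      _ ≤ p ^ k := Nat.pow_le_pow_right hp.pos hk2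
      _ ≤ X := hmX
  · refine Nat.le_log_of_pow_le one_lt_two ?_
    calc 2 ^ k ≤ p ^ k := Nat.pow_le_pow_left hp.two_le k
      _ ≤ X := hmX

/-- There are at most `√X · log₂ X` higher prime powers up to `X`. [folklore] -/
theorem card_image_pow_le (X : ℕ) :
    #(((Icc 2 X.sqrt) ×ˢ (Icc 2 (Nat.log 2 X))).image fun pk : ℕ × ℕ => pk.1 ^ pk.2) ≤
      X.sqrt * Nat.log 2 X := by
  refine Finset.card_image_le.trans ?_
  rw [Finset.card_product, Nat.card_Icc, Nat.card_Icc]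
  exact Nat.mul_le_mul (by omega) (by omega)

/-- At most `√X · log₂ X · (2N+1)^{d-1}` points `n` of `s ⊆ [-N, N]^d` have `ψ(n)` equal to a
higher prime power `p^k ≤ X`, `k ≥ 2` (`ψ̇ ≠ 0`). [cite: GreenTao2010, Conj. 1.4 (sketch proof)] -/
theorem card_filter_higherPrimePow_le {N X : ℕ} (ψ : AffLinForm d) (hψ : ψ.coeff ≠ 0)
    (s : Finset (Fin d → ℤ)) (hs : s ⊆ latticeBox d N)
    [DecidablePred fun n : Fin d → ℤ =>
      IsPrimePow (ψ.eval n).toNat ∧ ¬ (ψ.eval n).toNat.Prime ∧ (ψ.eval n).toNat ≤ X] :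
    #(s.filter fun n =>
        IsPrimePow (ψ.eval n).toNat ∧ ¬ (ψ.eval n).toNat.Prime ∧ (ψ.eval n).toNat ≤ X) ≤
      X.sqrt * Nat.log 2 X * (2 * N + 1) ^ (d - 1) := by
  classical
  set V : Finset ℤ := (((Icc 2 X.sqrt) ×ˢ (Icc 2 (Nat.log 2 X))).image
    fun pk : ℕ × ℕ => pk.1 ^ pk.2).image (Nat.cast : ℕ → ℤ) with hV
  have hVcard : #V ≤ X.sqrt * Nat.log 2 X := Finset.card_image_le.trans (card_image_pow_le X)
  calc #(s.filter fun n =>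
          IsPrimePow (ψ.eval n).toNat ∧ ¬ (ψ.eval n).toNat.Prime ∧ (ψ.eval n).toNat ≤ X)
      ≤ #(s.filter fun n => ψ.eval n ∈ V) := by
        refine Finset.card_le_card fun n hn => ?_
        rw [Finset.mem_filter] at hn ⊢
        refine ⟨hn.1, ?_⟩
        obtain ⟨hpp, hnp, hX⟩ := hn.2
        have h2 := hpp.two_le
        have hpos : (0 : ℤ) ≤ ψ.eval n := by omega
        rw [hV, Finset.mem_image]
        exact ⟨(ψ.eval n).toNat, mem_image_pow_of_isPrimePow hpp hnp hX, Int.toNat_of_nonneg hpos⟩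
    _ ≤ #V * (2 * N + 1) ^ (d - 1) := card_filter_eval_mem_le ψ hψ V s hs
    _ ≤ X.sqrt * Nat.log 2 X * (2 * N + 1) ^ (d - 1) := Nat.mul_le_mul_right _ hVcard

/-! ### Casts of `Int.toNat` -/

/-- `m.toNat ≤ |m|` (as reals). [folklore] -/
theorem cast_toNat_le_abs (m : ℤ) : ((m.toNat : ℕ) : ℝ) ≤ |(m : ℝ)| := by
  rcases le_or_gt 0 m with hm | hm
  · have h1 : ((m.toNat : ℕ) : ℤ) = m := Int.toNat_of_nonneg hm
    have h2 : ((m.toNat : ℕ) : ℝ) = (m : ℝ) := by exact_mod_cast h1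
    rw [h2]
    exact le_abs_self _
  · have h1 : m.toNat = 0 := Int.toNat_eq_zero.mpr hm.le
    simp [h1]

/-- For `m ≥ 2` (e.g. `m.toNat` a prime power) the casts of `m.toNat` and `m` agree.
[folklore] -/
theorem cast_toNat_of_two_le {m : ℤ} (hm : 2 ≤ m.toNat) : ((m.toNat : ℕ) : ℝ) = (m : ℝ) := by
  have h0 : 0 ≤ m := by omega
  have h1 : ((m.toNat : ℕ) : ℤ) = m := Int.toNat_of_nonneg h0
  exact_mod_cast h1

/-! ### The sandwich between the von Mangoldt sum and the prime-point count -/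

/-- **Sandwich** (the combinatorial core of Green–Tao's sketch proof of Conj. 1.4). Let `N ≥ 1`,
`Ψ` nondegenerate of size `≤ L` at scale `N`, `K` arbitrary, `Y ≥ 1`, `0 ≤ a ≤ log Y` and
`log (2LN) ≤ b`. With `g = #{n ∈ K ∩ [-N,N]^d ∩ ℤ^d : every ψᵢ(n) is a prime > Y}`,
`β = ` the number of points with some `|ψᵢ(n)| ≤ Y` and `γ = ` the number with some `ψᵢ(n)` a
higher prime power: `a^t g ≤ ∑ ∏ Λ(ψᵢ(n)) ≤ b^t (g + β + γ)`, `g ≤ #{prime points} ≤ g + β`,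
`β ≤ t (2Y+1)(2N+1)^{d-1}`, `γ ≤ t √(2LN) log₂(2LN) (2N+1)^{d-1}`.
[cite: GreenTao2010, Conj. 1.4 (sketch proof)] -/
theorem vonMangoldtSum_primePointCount_sandwich {N L : ℕ} {Y a b : ℝ} (hN : 1 ≤ N)
    (Ψ : Fin t → AffLinForm d) (hΨ : IsNondegenerateSystem Ψ) (hL : affLinSize Ψ N ≤ L)
    (K : Set (Fin d → ℝ)) (ht : 1 ≤ t) (hY : 1 ≤ Y) (ha : 0 ≤ a) (haY : a ≤ Real.log Y)
    (hb : Real.log (2 * L * N) ≤ b) :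
    ∃ g β γ : ℝ, 0 ≤ g ∧ 0 ≤ β ∧ 0 ≤ γ ∧
      a ^ t * g ≤ vonMangoldtSum Ψ K N ∧ vonMangoldtSum Ψ K N ≤ b ^ t * (g + β + γ) ∧
      g ≤ primePointCount Ψ K N ∧ (primePointCount Ψ K N : ℝ) ≤ g + β ∧
      β ≤ t * ((2 * Y + 1) * (2 * N + 1) ^ (d - 1)) ∧
      γ ≤ t * ((Nat.sqrt (2 * L * N) : ℝ) * (Nat.log 2 (2 * L * N) : ℝ) *
        (2 * N + 1) ^ (d - 1)) := by
  classical
  obtain ⟨i₀⟩ : Nonempty (Fin t) := ⟨⟨0, ht⟩⟩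
  have hL1 : (1 : ℝ) ≤ L := one_le_of_affLinSize_le Ψ hΨ hL i₀
  have hN' : (1 : ℝ) ≤ N := by exact_mod_cast hN
  have hLN : (1 : ℝ) ≤ 2 * L * N := by nlinarith
  have hY0 : 0 < Y := by linarith
  have hb0 : 0 ≤ b := le_trans (Real.log_nonneg hLN) hb
  -- the sets
  set KB : Finset (Fin d → ℤ) := (latticeBox d N).filter fun n => realPoint n ∈ K with hKB
  have hKBsub : KB ⊆ latticeBox d N := Finset.filter_subset _ _
  set good : (Fin d → ℤ) → Prop := fun n =>
    ∀ i, ((Ψ i).eval n).toNat.Prime ∧ Y < ((Ψ i).eval n : ℝ) with hgood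
  set G : Finset (Fin d → ℤ) := KB.filter good with hG
  set B : Finset (Fin d → ℤ) := Finset.univ.biUnion fun i : Fin t =>
    KB.filter fun n => |((Ψ i).eval n : ℝ)| ≤ Y with hB
  set H : Finset (Fin d → ℤ) := Finset.univ.biUnion fun i : Fin t =>
    KB.filter fun n => IsPrimePow ((Ψ i).eval n).toNat ∧ ¬ ((Ψ i).eval n).toNat.Prime ∧
      ((Ψ i).eval n).toNat ≤ 2 * L * N with hH
  set f : (Fin d → ℤ) → ℝ := fun n => ∏ i, intVonMangoldt ((Ψ i).eval n) with hf
  have hS : vonMangoldtSum Ψ K N = ∑ n ∈ KB, f n := rfl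
  have hP : primePointCount Ψ K N =
      #((latticeBox d N).filter fun n => realPoint n ∈ K ∧ ∀ i, ((Ψ i).eval n).toNat.Prime) :=
    rfl
  -- pointwise facts
  have hf0 : ∀ n, 0 ≤ f n := fun n => Finset.prod_nonneg fun i _ => intVonMangoldt_nonneg _
  have hvals : ∀ n ∈ KB, ∀ i, |((Ψ i).eval n : ℝ)| ≤ 2 * L * N := fun n hn i =>
    abs_eval_le_of_affLinSize_le hN hL (hKBsub hn) i
  have hfb : ∀ n ∈ KB, f n ≤ b ^ t := by
    intro n hn
    calc f n ≤ ∏ _i : Fin t, b := Finset.prod_le_prod (fun i _ => intVonMangoldt_nonneg _)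
          (fun i _ =>
            (intVonMangoldt_le_log hLN ((le_abs_self _).trans (hvals n hn i))).trans hb)
      _ = b ^ t := by simp
  have hfa : ∀ n ∈ G, a ^ t ≤ f n := by
    intro n hn
    rw [hG, Finset.mem_filter] at hn
    have hgn : good n := hn.2
    calc a ^ t = ∏ _i : Fin t, a := by simp
      _ ≤ f n := Finset.prod_le_prod (fun i _ => ha) fun i _ => ?_
    obtain ⟨hp, hYlt⟩ := hgn i
    have hcast : ((((Ψ i).eval n).toNat : ℕ) : ℝ) = ((Ψ i).eval n : ℝ) :=
      cast_toNat_of_two_le hp.two_le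
    show a ≤ intVonMangoldt ((Ψ i).eval n)
    unfold intVonMangoldt
    rw [ArithmeticFunction.vonMangoldt_apply_prime hp, hcast]
    exact haY.trans (Real.log_le_log hY0 hYlt.le)
  -- a value `≤ Y` of a point all of whose values are `≥ 2` puts the point in `B`
  have hmemB : ∀ n ∈ KB, ∀ i, 2 ≤ ((Ψ i).eval n).toNat → ((Ψ i).eval n : ℝ) ≤ Y → n ∈ B := by
    intro n hn i h2 hle
    have h0 : (0 : ℝ) ≤ ((Ψ i).eval n : ℝ) := by
      have : (0 : ℤ) ≤ (Ψ i).eval n := by omega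
      exact_mod_cast this
    rw [hB, Finset.mem_biUnion]
    refine ⟨i, Finset.mem_univ i, Finset.mem_filter.mpr ⟨hn, ?_⟩⟩
    rw [abs_of_nonneg h0]
    exact hle
  -- outside `G`, the support of `f` lies in `B ∪ H`
  have hsupp : ∀ n ∈ KB, ¬ good n → f n ≠ 0 → n ∈ B ∪ H := by
    intro n hn hng hfn
    have hpp : ∀ i, IsPrimePow ((Ψ i).eval n).toNat := fun i =>
      ArithmeticFunction.vonMangoldt_ne_zero_iff.mp
        (Finset.prod_ne_zero_iff.mp hfn i (Finset.mem_univ i))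
    obtain ⟨i, hi⟩ := not_forall.mp hng
    rw [Finset.mem_union]
    by_cases hpr : ((Ψ i).eval n).toNat.Prime
    · left
      have hle : ((Ψ i).eval n : ℝ) ≤ Y := by
        by_contra hlt
        exact hi ⟨hpr, lt_of_not_ge hlt⟩
      exact hmemB n hn i (hpp i).two_le hle
    · right
      rw [hH, Finset.mem_biUnion]
      refine ⟨i, Finset.mem_univ i, Finset.mem_filter.mpr ⟨hn, hpp i, hpr, ?_⟩⟩
      have := (cast_toNat_le_abs ((Ψ i).eval n)).trans (hvals n hn i)
      exact_mod_cast this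
  refine ⟨#G, #B, #H, by positivity, by positivity, by positivity, ?_, ?_, ?_, ?_, ?_, ?_⟩
  · -- `a^t #G ≤ S`
    rw [hS]
    calc a ^ t * #G = ∑ _n ∈ G, a ^ t := by rw [Finset.sum_const, nsmul_eq_mul, mul_comm]
      _ ≤ ∑ n ∈ G, f n := Finset.sum_le_sum hfa
      _ ≤ ∑ n ∈ KB, f n :=
        Finset.sum_le_sum_of_subset_of_nonneg (Finset.filter_subset _ _) fun n _ _ => hf0 n
  · -- `S ≤ b^t (#G + #B + #H)`
    rw [hS, ← Finset.sum_filter_add_sum_filter_not KB good]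
    have h1 : ∑ n ∈ KB.filter good, f n ≤ b ^ t * #G := by
      calc ∑ n ∈ KB.filter good, f n ≤ ∑ _n ∈ KB.filter good, b ^ t :=
            Finset.sum_le_sum fun n hn => hfb n (Finset.mem_of_mem_filter n hn)
        _ = b ^ t * #G := by rw [Finset.sum_const, nsmul_eq_mul, mul_comm, hG]
    have h2 : ∑ n ∈ KB.filter (fun n => ¬ good n), f n ≤ b ^ t * (#B + #H) := by
      calc ∑ n ∈ KB.filter (fun n => ¬ good n), f n
          = ∑ n ∈ (KB.filter fun n => ¬ good n).filter (fun n => f n ≠ 0), f n :=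
            (Finset.sum_filter_ne_zero _).symm
        _ ≤ ∑ n ∈ (B ∪ H).filter (fun n => n ∈ KB), f n := by
            refine Finset.sum_le_sum_of_subset_of_nonneg (fun n hn => ?_) fun n _ _ => hf0 n
            simp only [Finset.mem_filter] at hn ⊢
            exact ⟨hsupp n hn.1.1 hn.1.2 hn.2, hn.1.1⟩
        _ ≤ ∑ _n ∈ (B ∪ H).filter (fun n => n ∈ KB), b ^ t :=
            Finset.sum_le_sum fun n hn => hfb n (Finset.mem_filter.mp hn).2
        _ = b ^ t * #((B ∪ H).filter fun n => n ∈ KB) := by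
            rw [Finset.sum_const, nsmul_eq_mul, mul_comm]
        _ ≤ b ^ t * (#B + #H) := by
            have : (#((B ∪ H).filter fun n => n ∈ KB) : ℝ) ≤ #B + #H := by
              exact_mod_cast (Finset.card_filter_le _ _).trans (Finset.card_union_le _ _)
            exact mul_le_mul_of_nonneg_left this (pow_nonneg hb0 t)
    calc ∑ n ∈ KB.filter good, f n + ∑ n ∈ KB.filter (fun n => ¬ good n), f n
        ≤ b ^ t * #G + b ^ t * (#B + #H) := add_le_add h1 h2
      _ = b ^ t * (#G + #B + #H) := by ring
  · -- `#G ≤ P`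
    rw [hP]
    exact_mod_cast Finset.card_le_card fun n hn => by
      rw [hG, Finset.mem_filter, hKB, Finset.mem_filter] at hn
      exact Finset.mem_filter.mpr ⟨hn.1.1, hn.1.2, fun i => (hn.2 i).1⟩
  · -- `P ≤ #G + #B`
    rw [hP]
    have h1 : #((latticeBox d N).filter fun n =>
        realPoint n ∈ K ∧ ∀ i, ((Ψ i).eval n).toNat.Prime) ≤ #(G ∪ B) := by
      refine Finset.card_le_card fun n hn => ?_
      rw [Finset.mem_filter] at hn
      have hnKB : n ∈ KB := by
        rw [hKB, Finset.mem_filter]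
        exact ⟨hn.1, hn.2.1⟩
      rw [Finset.mem_union]
      by_cases hgn : good n
      · left
        rw [hG, Finset.mem_filter]
        exact ⟨hnKB, hgn⟩
      · right
        obtain ⟨i, hi⟩ := not_forall.mp hgn
        have hpr := hn.2.2 i
        have hle : ((Ψ i).eval n : ℝ) ≤ Y := by
          by_contra hlt
          exact hi ⟨hpr, lt_of_not_ge hlt⟩
        exact hmemB n hnKB i hpr.two_le hle
    exact_mod_cast h1.trans (Finset.card_union_le _ _)
  · -- `#B ≤ t (2Y+1)(2N+1)^{d-1}`
    calc (#B : ℝ) ≤ ∑ i : Fin t, (#(KB.filter fun n => |((Ψ i).eval n : ℝ)| ≤ Y) : ℝ) := by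
          rw [hB]
          exact_mod_cast Finset.card_biUnion_le
      _ ≤ ∑ _i : Fin t, (2 * Y + 1) * (2 * N + 1) ^ (d - 1) :=
          Finset.sum_le_sum fun i _ => card_filter_abs_eval_le hY0.le (Ψ i) (hΨ.1 i) KB hKBsub
      _ = t * ((2 * Y + 1) * (2 * N + 1) ^ (d - 1)) := by simp
  · -- `#H ≤ t √(2LN) log₂(2LN) (2N+1)^{d-1}`
    have h1 : #H ≤ ∑ i : Fin t, #(KB.filter fun n => IsPrimePow ((Ψ i).eval n).toNat ∧
        ¬ ((Ψ i).eval n).toNat.Prime ∧ ((Ψ i).eval n).toNat ≤ 2 * L * N) := by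
      rw [hH]
      exact Finset.card_biUnion_le
    have h2 : ∀ i, #(KB.filter fun n => IsPrimePow ((Ψ i).eval n).toNat ∧
        ¬ ((Ψ i).eval n).toNat.Prime ∧ ((Ψ i).eval n).toNat ≤ 2 * L * N) ≤
        Nat.sqrt (2 * L * N) * Nat.log 2 (2 * L * N) * (2 * N + 1) ^ (d - 1) := fun i =>
      card_filter_higherPrimePow_le (Ψ i) (hΨ.1 i) KB hKBsub
    have h3 : #H ≤
        t * (Nat.sqrt (2 * L * N) * Nat.log 2 (2 * L * N) * (2 * N + 1) ^ (d - 1)) := by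
      refine h1.trans ((Finset.sum_le_sum fun i _ => h2 i).trans ?_)
      simp
    exact_mod_cast h3


end Literature.NumberTheory.Sieve
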